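import Literature.NumberTheory.Automorphic.GraphGroupTorus
import Literature.NumberTheory.Automorphic.ChevalleyIsomorphismOfAbstract
import HarnessLib

/-!
# The isomorphism theorem for reductive groups in characteristic `0` by the graph method, II:
the graph group is the graph of an isomorphism inducing the identity of the root datum
(trunk T-AUTOMORPHIC, G25 AutomorphicL; Springer 9.6.2, step 1 — a second, Lie-algebra-isomorphism
route to `chevalley_isomorphism_abstract`, alongside `ReductiveDualAbstractIsomorphism.lean`)

Conclusion of the graph proof (`LieGraphSetup/Core/Swap/Commutant/Center/Isomorphism.lean` for the
Lie algebras; `GraphGroupCompat.lean`, `GraphGroupTorus.lean` for the groups; the graph group `H`,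
graph torus `T̃` and their generators are those of `IsomorphismGraphGroup.lean`). For connected
reductive `(G₁, T₁) ≤ GL_{N}`, `(G₂, T₂) ≤ GL_{N'}` over an algebraically closed field of
characteristic `0` with the same root datum `P`:

* `isConnectedReductive_graphGroup` — `H` is connected reductive (a connected unipotent normal
  subgroup of `H` projects onto connected unipotent normal subgroups of `G₁`, `G₂`, which are
  trivial);
* `eq_one_of_inrBlock_mem_graphGroup`, `eq_one_of_inlBlock_mem_graphGroup` — **`H` meets `1 × G₂` and
  `G₁ × 1` trivially**: such an element lies in the torus (`GraphGroupCompat`), centralises the maximal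
  torus `T̃` of `H` (`GraphGroupTorus.isMaximalTorusIn_graphTorus`), hence lies in `Z_H(T̃) = T̃`
  (Springer 7.6.4 (ii), `centralizer_eq_of_isMaximalTorusIn_holds`), whose elements `diag(t, f_T t)`
  with a trivial block are trivial;
* `graphIso` — hence `H` is the graph of an isomorphism of abstract groups `G₁ ≃* G₂`
  (`blockDiagGL_graphIso_mem`, `graphIso_eq_of_mem`), which induces the identity of the root datum
  (`inducesRootDatumId_graphIso`: on `T₁` it is `f_T`; it carries `u_i = φ_i ∘ u⁺` to the root
  homomorphism `x ↦ exp (x ψ(e¹_i))` of `G₂` for *every* root — for the value `z_x ∈ T₂` of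
  `(graphIso (u_i x))⁻¹ exp (x ψ e¹_i)` is independent of `x ≠ 0` by the torus action and then `1` by
  additivity, `graphIso_expHom_rootE`);
* `LieGraph.inducesRootDatumId_graphIso` — for `Fin`-indexed groups (as `InducesRootDatumId` requires)
  `graphIso` induces the identity of the root datum; this is exactly the content of the named fact
  `chevalley_isomorphism_abstract`, whose discharge `chevalley_isomorphism_abstract_holds` landed in
  `ReductiveDualAbstractIsomorphism.lean` (the sibling graph-method route through the weights of
  `Lie(H)`) while this chain was being completed; the present file is kept as the independent route
  through the Lie-algebra isomorphism `ψ` (which also yields the root-homomorphism compatibility for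
  every root with the *normalised* `u'_i = exp (x ψ e¹_i)`, no scalar `c_α`), and
  `chevalley_isomorphism_holds` (`ChevalleyIsomorphismHolds.lean`) is the discharge of Springer 9.6.2.

Everything is proved; no named fact is introduced.

## Mathlib / Literature

Searched `chevalley_isomorphism_abstract_holds`, `graphIso`, `inducesRootDatumId_graphIso`,
`InducesRootDatumId`: `ReductiveDualAbstractIsomorphism.lean` has top-level `graphIso`,
`graphIso_torus`, `inducesRootDatumId_graphIso`, `chevalley_isomorphism_abstract_holds` for the graph
group of a *base* `b` with its own kernel analysis (`IsomorphismGraphKernel.lean`); the declarations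
here live in the namespace `LieGraph`, concern the graph group of the simple roots of a regular
coweight and rest on `GraphGroupCompat/GraphGroupTorus.lean`; the named facts are not restated
(`chevalley_isomorphism_abstract_holds` is imported where needed, `chevalley_isomorphism_holds` is
`ChevalleyIsomorphismHolds.lean`). `IsUnipotentElt`, `IsReductiveSubgroup` are the vocabulary of
`LinearAlgebraicGroups.lean`. Nothing here duplicates a Mathlib or Literature declaration.

## References

* [SpringerLAG1998] T. A. Springer, *Linear Algebraic Groups*, 2nd ed. (1998), Theorem 9.6.2 and its
  proof, 7.6.4 (ii), 8.1.1.
* J. E. Humphreys, *Linear Algebraic Groups*, GTM 21 (1975), §32–33 (the graph method).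
* J. E. Humphreys, *Introduction to Lie Algebras and Representation Theory* (1972), 14.2.
-/

noncomputable section

open scoped MatrixGroups IsMulCommutative
open Set

attribute [local instance 100] LieRing.ofAssociativeRing

namespace Literature.NumberTheory.Automorphic

namespace LieGraph

variable {k : Type*} [Field k]
variable {n₁ n₂ : Type*} [Fintype n₁] [DecidableEq n₁] [Fintype n₂] [DecidableEq n₂]
variable {ι X Y : Type*} [AddCommGroup X] [AddCommGroup Y]
variable {G₁ T₁ : Subgroup (GL n₁ k)} {G₂ T₂ : Subgroup (GL n₂ k)}
  [IsMulCommutative ↥T₁] [IsMulCommutative ↥T₂]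
variable {P : RootPairing ι ℤ X Y}
variable {eX₁ : Additive ↥(characterLattice T₁) ≃+ X} {eY₁ : Additive ↥(cocharacterLattice T₁) ≃+ Y}
variable {eX₂ : Additive ↥(characterLattice T₂) ≃+ X} {eY₂ : Additive ↥(cocharacterLattice T₂) ≃+ Y}

variable [IsAlgClosed k] [CharZero k] [Fintype ι]
variable (hG₁ : IsConnectedReductive G₁) (hT₁ : IsMaximalTorusIn T₁ G₁)
  (hG₂ : IsConnectedReductive G₂) (hT₂ : IsMaximalTorusIn T₂ G₂)
  (h₁ : IsRootDatumOf G₁ T₁ P eX₁ eY₁) (h₂ : IsRootDatumOf G₂ T₂ P eX₂ eY₂)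

/-! ### `H` is connected reductive -/

omit [IsMulCommutative ↥T₁] [IsMulCommutative ↥T₂] [IsAlgClosed k] [CharZero k] [Fintype ι] in
/-- The blocks of a unipotent block-diagonal element are unipotent. [folklore] -/
lemma isUnipotentElt_blocks {a : GL n₁ k} {b : GL n₂ k} (hu : IsUnipotentElt (blockDiagGL (a, b))) :
    IsUnipotentElt a ∧ IsUnipotentElt b := by
  unfold IsUnipotentElt at hu ⊢
  rw [coe_blockDiagGL] at hu
  have e : Matrix.fromBlocks (a : Matrix n₁ n₁ k) 0 0 (b : Matrix n₂ n₂ k) - 1 =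
      Matrix.fromBlocks ((a : Matrix n₁ n₁ k) - 1) 0 0 ((b : Matrix n₂ n₂ k) - 1) := by
    rw [← Matrix.fromBlocks_one, sub_eq_add_neg, Matrix.fromBlocks_neg, Matrix.fromBlocks_add]
    simp [sub_eq_add_neg]
  rw [e] at hu
  exact ⟨isNilpotent_of_fromBlocks₁ hu, isNilpotent_of_fromBlocks₂ hu⟩

include hG₁ hG₂ in
/-- **The graph group `H` is connected reductive.** [cite: SpringerLAG1998, 9.6.2] -/
theorem isConnectedReductive_graphGroup {y : Y} (hy : ∀ i, P.root' i y ≠ 0) :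
    IsConnectedReductive (graphGroup h₁ h₂ hT₁.2.1 hT₂.2.1 (simpleRoots P y)) := by
  set H := graphGroup h₁ h₂ hT₁.2.1 hT₂.2.1 (simpleRoots P y) with hH
  have hHb : H ≤ blockDiagRange n₁ n₂ k := graphGroup_le_blockDiagRange h₁ h₂ hT₁.2.1 hT₂.2.1 _
  refine ⟨isZConnected_graphGroup h₁ h₂ hT₁.2.1 hT₂.2.1 _, (isZConnected_graphGroup h₁ h₂ hT₁.2.1 hT₂.2.1 _).1,
    fun U hUH hUn hUc hUu => ?_⟩
  have hUb : U ≤ blockDiagRange n₁ n₂ k := hUH.trans hHb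
  -- the projections of `U` are trivial
  have hU₁ : fstOf U hUb = ⊥ := by
    refine hG₁.2.2 (fstOf U hUb) ?_ ?_ ((isAlgebraicGL_fstBlockGL_comp hUb).isZConnected_range hUc) ?_
    · rintro _ ⟨u, rfl⟩
      exact (fstBlockGL_mem_of_mem_prodBlock (graphGroup_le_prodBlock h₁ h₂ hT₁.2.1 hT₂.2.1 _ (hUH u.2))).1
    · refine ⟨fun a ha g => ?_⟩
      obtain ⟨u, hu⟩ := ha
      obtain ⟨g₂, hg₂, hgH⟩ := exists_blockDiagGL_mem_graphGroup hG₁ hT₁ hT₂ h₁ h₂ hy g.2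
      have hu' := hUH u.2
      obtain ⟨u₁, hu₁, u₂, hu₂, hue⟩ := mem_prodBlock_iff.1 (graphGroup_le_prodBlock h₁ h₂ hT₁.2.1 hT₂.2.1 _ hu')
      have hconj : blockDiagGL ((g : GL n₁ k), g₂) * (u : GL (n₁ ⊕ n₂) k) * (blockDiagGL ((g : GL n₁ k), g₂))⁻¹ ∈ U := by
        have := hUn.conj_mem ⟨u, hUH u.2⟩ (Subgroup.mem_subgroupOf.2 u.2) ⟨_, hgH⟩
        exact Subgroup.mem_subgroupOf.1 this
      refine ⟨⟨_, hconj⟩, ?_⟩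
      have hua : fstBlockGL (Subgroup.inclusion hUb u) = u₁ := by
        rw [show Subgroup.inclusion hUb u = ⟨blockDiagGL (u₁, u₂), blockDiagGL_mem_blockDiagRange _⟩ from
          Subtype.ext hue.symm, fstBlockGL_mk]
      rw [MonoidHom.comp_apply, hua] at hu
      try rw [Subgroup.coe_subtype] at hu
      rw [Subgroup.coe_subtype, Subgroup.coe_mul, Subgroup.coe_mul, Subgroup.coe_inv, ← hu, MonoidHom.comp_apply,
        show Subgroup.inclusion hUb ⟨_, hconj⟩ = ⟨blockDiagGL ((g : GL n₁ k) * u₁ * (g : GL n₁ k)⁻¹, g₂ * u₂ * g₂⁻¹),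
          blockDiagGL_mem_blockDiagRange _⟩ from Subtype.ext (by
            simp only [Subgroup.coe_inclusion, ← hue, ← map_mul, ← map_inv, Prod.mk_mul_mk, Prod.inv_mk]),
        fstBlockGL_mk]
    · rintro _ ⟨u, rfl⟩
      have hu' := hUH u.2
      obtain ⟨u₁, hu₁, u₂, hu₂, hue⟩ := mem_prodBlock_iff.1 (graphGroup_le_prodBlock h₁ h₂ hT₁.2.1 hT₂.2.1 _ hu')
      have : fstBlockGL (Subgroup.inclusion hUb u) = u₁ := by
        rw [show Subgroup.inclusion hUb u = ⟨blockDiagGL (u₁, u₂), blockDiagGL_mem_blockDiagRange _⟩ from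
          Subtype.ext hue.symm, fstBlockGL_mk]
      rw [MonoidHom.comp_apply, this]
      have huu := hUu u u.2
      rw [← hue] at huu
      exact (isUnipotentElt_blocks huu).1
  have hU₂ : sndOf U hUb = ⊥ := by
    refine hG₂.2.2 (sndOf U hUb) ?_ ?_ ((isAlgebraicGL_sndBlockGL_comp hUb).isZConnected_range hUc) ?_
    · rintro _ ⟨u, rfl⟩
      exact (fstBlockGL_mem_of_mem_prodBlock (graphGroup_le_prodBlock h₁ h₂ hT₁.2.1 hT₂.2.1 _ (hUH u.2))).2
    · refine ⟨fun a ha g => ?_⟩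
      obtain ⟨u, hu⟩ := ha
      obtain ⟨g₁, hg₁, hgH⟩ := exists_blockDiagGL_mem_graphGroup' hT₁ hG₂ hT₂ h₁ h₂ hy g.2
      have hu' := hUH u.2
      obtain ⟨u₁, hu₁, u₂, hu₂, hue⟩ := mem_prodBlock_iff.1 (graphGroup_le_prodBlock h₁ h₂ hT₁.2.1 hT₂.2.1 _ hu')
      have hconj : blockDiagGL (g₁, (g : GL n₂ k)) * (u : GL (n₁ ⊕ n₂) k) * (blockDiagGL (g₁, (g : GL n₂ k)))⁻¹ ∈ U := by
        have := hUn.conj_mem ⟨u, hUH u.2⟩ (Subgroup.mem_subgroupOf.2 u.2) ⟨_, hgH⟩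
        exact Subgroup.mem_subgroupOf.1 this
      refine ⟨⟨_, hconj⟩, ?_⟩
      have hua : sndBlockGL (Subgroup.inclusion hUb u) = u₂ := by
        rw [show Subgroup.inclusion hUb u = ⟨blockDiagGL (u₁, u₂), blockDiagGL_mem_blockDiagRange _⟩ from
          Subtype.ext hue.symm, sndBlockGL_mk]
      rw [MonoidHom.comp_apply, hua] at hu
      try rw [Subgroup.coe_subtype] at hu
      rw [Subgroup.coe_subtype, Subgroup.coe_mul, Subgroup.coe_mul, Subgroup.coe_inv, ← hu, MonoidHom.comp_apply,
        show Subgroup.inclusion hUb ⟨_, hconj⟩ = ⟨blockDiagGL (g₁ * u₁ * g₁⁻¹, (g : GL n₂ k) * u₂ * (g : GL n₂ k)⁻¹),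
          blockDiagGL_mem_blockDiagRange _⟩ from Subtype.ext (by
            simp only [Subgroup.coe_inclusion, ← hue, ← map_mul, ← map_inv, Prod.mk_mul_mk, Prod.inv_mk]),
        sndBlockGL_mk]
    · rintro _ ⟨u, rfl⟩
      have hu' := hUH u.2
      obtain ⟨u₁, hu₁, u₂, hu₂, hue⟩ := mem_prodBlock_iff.1 (graphGroup_le_prodBlock h₁ h₂ hT₁.2.1 hT₂.2.1 _ hu')
      have : sndBlockGL (Subgroup.inclusion hUb u) = u₂ := by
        rw [show Subgroup.inclusion hUb u = ⟨blockDiagGL (u₁, u₂), blockDiagGL_mem_blockDiagRange _⟩ from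
          Subtype.ext hue.symm, sndBlockGL_mk]
      rw [MonoidHom.comp_apply, this]
      have huu := hUu u u.2
      rw [← hue] at huu
      exact (isUnipotentElt_blocks huu).2
  -- hence `U` is trivial
  rw [Subgroup.eq_bot_iff_forall]
  intro u hu
  have hu' := hUH hu
  obtain ⟨u₁, hu₁, u₂, hu₂, hue⟩ := mem_prodBlock_iff.1 (graphGroup_le_prodBlock h₁ h₂ hT₁.2.1 hT₂.2.1 _ hu')
  have e1 : u₁ = 1 := by
    have : fstBlockGL (Subgroup.inclusion hUb ⟨u, hu⟩) ∈ fstOf U hUb := ⟨⟨u, hu⟩, rfl⟩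
    rw [hU₁, Subgroup.mem_bot, show Subgroup.inclusion hUb ⟨u, hu⟩ =
      ⟨blockDiagGL (u₁, u₂), blockDiagGL_mem_blockDiagRange _⟩ from Subtype.ext hue.symm, fstBlockGL_mk] at this
    exact this
  have e2 : u₂ = 1 := by
    have : sndBlockGL (Subgroup.inclusion hUb ⟨u, hu⟩) ∈ sndOf U hUb := ⟨⟨u, hu⟩, rfl⟩
    rw [hU₂, Subgroup.mem_bot, show Subgroup.inclusion hUb ⟨u, hu⟩ =
      ⟨blockDiagGL (u₁, u₂), blockDiagGL_mem_blockDiagRange _⟩ from Subtype.ext hue.symm, sndBlockGL_mk] at this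
    exact this
  rw [← hue, e1, e2, ← Prod.one_eq_mk, map_one]

/-! ### `H` is a graph over both factors -/

include hG₁ hG₂ in
/-- **`diag(1, z) ∈ H ⇒ z = 1`.** [cite: SpringerLAG1998, 9.6.2 and 7.6.4] -/
theorem eq_one_of_inrBlock_mem_graphGroup {y : Y} (hy : ∀ i, P.root' i y ≠ 0) {z : GL n₂ k}
    (hz : inrBlock z ∈ graphGroup h₁ h₂ hT₁.2.1 hT₂.2.1 (simpleRoots P y)) : z = 1 := by
  have hzT : z ∈ T₂ := mem_torus_of_inrBlock_mem_graphGroup hG₁ hT₁ hG₂ hT₂ h₁ h₂ hy hz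
  have hcent := centralizer_eq_of_isMaximalTorusIn_holds (isConnectedReductive_graphGroup hG₁ hT₁ hG₂ hT₂ h₁ h₂ hy)
    (isMaximalTorusIn_graphTorus hG₁ hT₁ hG₂ hT₂ h₁ h₂ hy)
  have hmem : inrBlock z ∈ graphTorus eX₁ eX₂ hT₁.2.1 hT₂.2.1 := by
    rw [← hcent]
    refine ⟨hz, Subgroup.mem_centralizer_iff.2 ?_⟩
    rintro _ ⟨t, rfl⟩
    rw [graphTorusHom_apply, inrBlock_apply, ← map_mul, ← map_mul, Prod.mk_mul_mk, Prod.mk_mul_mk, one_mul, mul_one]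
    congr 2
    exact congrArg Subtype.val (hT₂.2.1.2.1.is_comm.comm (torusIsoOfWeights eX₁ eX₂ hT₁.2.1 hT₂.2.1 t) ⟨z, hzT⟩)
  obtain ⟨t, ht⟩ := hmem
  rw [graphTorusHom_apply, inrBlock_apply] at ht
  obtain ⟨ht1, ht2⟩ := Prod.ext_iff.1 (blockDiagGL_injective ht)
  simp only at ht1 ht2
  have : t = 1 := Subtype.ext ht1
  rw [this, map_one] at ht2
  simpa using ht2.symm

include hG₁ hG₂ in
/-- **`diag(z, 1) ∈ H ⇒ z = 1`.** [cite: SpringerLAG1998, 9.6.2 and 7.6.4] -/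
theorem eq_one_of_inlBlock_mem_graphGroup {y : Y} (hy : ∀ i, P.root' i y ≠ 0) {z : GL n₁ k}
    (hz : inlBlock z ∈ graphGroup h₁ h₂ hT₁.2.1 hT₂.2.1 (simpleRoots P y)) : z = 1 := by
  have hzT : z ∈ T₁ := mem_torus_of_inlBlock_mem_graphGroup hG₁ hT₁ hG₂ hT₂ h₁ h₂ hy hz
  have hcent := centralizer_eq_of_isMaximalTorusIn_holds (isConnectedReductive_graphGroup hG₁ hT₁ hG₂ hT₂ h₁ h₂ hy)
    (isMaximalTorusIn_graphTorus hG₁ hT₁ hG₂ hT₂ h₁ h₂ hy)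
  have hmem : inlBlock z ∈ graphTorus eX₁ eX₂ hT₁.2.1 hT₂.2.1 := by
    rw [← hcent]
    refine ⟨hz, Subgroup.mem_centralizer_iff.2 ?_⟩
    rintro _ ⟨t, rfl⟩
    rw [graphTorusHom_apply, inlBlock_apply, ← map_mul, ← map_mul, Prod.mk_mul_mk, Prod.mk_mul_mk, one_mul, mul_one]
    congr 2
    exact congrArg Subtype.val (hT₁.2.1.2.1.is_comm.comm t ⟨z, hzT⟩)
  obtain ⟨t, ht⟩ := hmem
  rw [graphTorusHom_apply, inlBlock_apply] at ht
  obtain ⟨ht1, ht2⟩ := Prod.ext_iff.1 (blockDiagGL_injective ht)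
  simp only at ht1 ht2
  have ht1' : t = 1 := by
    have : torusIsoOfWeights eX₁ eX₂ hT₁.2.1 hT₂.2.1 t = 1 := Subtype.ext ht2
    exact (torusIsoOfWeights eX₁ eX₂ hT₁.2.1 hT₂.2.1).injective (by rw [this, map_one])
  rw [ht1'] at ht1
  exact ht1.symm

include hG₁ hG₂ in
/-- Uniqueness of the second block. [cite: SpringerLAG1998, 9.6.2] -/
theorem snd_unique {y : Y} (hy : ∀ i, P.root' i y ≠ 0) {g₁ : GL n₁ k} {a b : GL n₂ k}
    (ha : blockDiagGL (g₁, a) ∈ graphGroup h₁ h₂ hT₁.2.1 hT₂.2.1 (simpleRoots P y))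
    (hb : blockDiagGL (g₁, b) ∈ graphGroup h₁ h₂ hT₁.2.1 hT₂.2.1 (simpleRoots P y)) : a = b := by
  have hmem := Subgroup.mul_mem _ (Subgroup.inv_mem _ ha) hb
  rw [← map_inv, ← map_mul, Prod.inv_mk, Prod.mk_mul_mk, inv_mul_cancel, ← inrBlock_apply] at hmem
  have := eq_one_of_inrBlock_mem_graphGroup hG₁ hT₁ hG₂ hT₂ h₁ h₂ hy hmem
  rwa [inv_mul_eq_one] at this

include hG₁ hG₂ in
/-- Uniqueness of the first block. [cite: SpringerLAG1998, 9.6.2] -/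
theorem fst_unique {y : Y} (hy : ∀ i, P.root' i y ≠ 0) {g₂ : GL n₂ k} {a b : GL n₁ k}
    (ha : blockDiagGL (a, g₂) ∈ graphGroup h₁ h₂ hT₁.2.1 hT₂.2.1 (simpleRoots P y))
    (hb : blockDiagGL (b, g₂) ∈ graphGroup h₁ h₂ hT₁.2.1 hT₂.2.1 (simpleRoots P y)) : a = b := by
  have hmem := Subgroup.mul_mem _ (Subgroup.inv_mem _ ha) hb
  rw [← map_inv, ← map_mul, Prod.inv_mk, Prod.mk_mul_mk, inv_mul_cancel, ← inlBlock_apply] at hmem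
  have := eq_one_of_inlBlock_mem_graphGroup hG₁ hT₁ hG₂ hT₂ h₁ h₂ hy hmem
  rwa [inv_mul_eq_one] at this

/-- The function `G₁ → G₂` whose graph is `H`. [folklore] -/
def graphIsoFun {y : Y} (hy : ∀ i, P.root' i y ≠ 0) (g : ↥G₁) : ↥G₂ :=
  ⟨(exists_blockDiagGL_mem_graphGroup hG₁ hT₁ hT₂ h₁ h₂ hy g.2).choose,
    (exists_blockDiagGL_mem_graphGroup hG₁ hT₁ hT₂ h₁ h₂ hy g.2).choose_spec.1⟩

/-- Graph property of `graphIsoFun`. [folklore] -/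
lemma blockDiagGL_graphIsoFun_mem {y : Y} (hy : ∀ i, P.root' i y ≠ 0) (g : ↥G₁) :
    blockDiagGL ((g : GL n₁ k), ((graphIsoFun hG₁ hT₁ hT₂ h₁ h₂ hy g : ↥G₂) : GL n₂ k)) ∈
      graphGroup h₁ h₂ hT₁.2.1 hT₂.2.1 (simpleRoots P y) :=
  (exists_blockDiagGL_mem_graphGroup hG₁ hT₁ hT₂ h₁ h₂ hy g.2).choose_spec.2

/-- The inverse function. [folklore] -/
def graphIsoInv {y : Y} (hy : ∀ i, P.root' i y ≠ 0) (g : ↥G₂) : ↥G₁ :=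
  ⟨(exists_blockDiagGL_mem_graphGroup' hT₁ hG₂ hT₂ h₁ h₂ hy g.2).choose,
    (exists_blockDiagGL_mem_graphGroup' hT₁ hG₂ hT₂ h₁ h₂ hy g.2).choose_spec.1⟩

/-- Graph property of `graphIsoInv`. [folklore] -/
lemma blockDiagGL_graphIsoInv_mem {y : Y} (hy : ∀ i, P.root' i y ≠ 0) (g : ↥G₂) :
    blockDiagGL (((graphIsoInv hT₁ hG₂ hT₂ h₁ h₂ hy g : ↥G₁) : GL n₁ k), (g : GL n₂ k)) ∈
      graphGroup h₁ h₂ hT₁.2.1 hT₂.2.1 (simpleRoots P y) :=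
  (exists_blockDiagGL_mem_graphGroup' hT₁ hG₂ hT₂ h₁ h₂ hy g.2).choose_spec.2

include hG₁ hG₂ in
/-- **The isomorphism of abstract groups `G₁ ≃* G₂` whose graph is `H`.** [cite: SpringerLAG1998, 9.6.2] -/
def graphIso {y : Y} (hy : ∀ i, P.root' i y ≠ 0) : ↥G₁ ≃* ↥G₂ where
  toFun := graphIsoFun hG₁ hT₁ hT₂ h₁ h₂ hy
  invFun := graphIsoInv hT₁ hG₂ hT₂ h₁ h₂ hy
  left_inv g := Subtype.ext (fst_unique hG₁ hT₁ hG₂ hT₂ h₁ h₂ hy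
    (blockDiagGL_graphIsoInv_mem hT₁ hG₂ hT₂ h₁ h₂ hy _) (blockDiagGL_graphIsoFun_mem hG₁ hT₁ hT₂ h₁ h₂ hy g))
  right_inv g := Subtype.ext (snd_unique hG₁ hT₁ hG₂ hT₂ h₁ h₂ hy
    (blockDiagGL_graphIsoFun_mem hG₁ hT₁ hT₂ h₁ h₂ hy _) (blockDiagGL_graphIsoInv_mem hT₁ hG₂ hT₂ h₁ h₂ hy g))
  map_mul' g g' := Subtype.ext (snd_unique hG₁ hT₁ hG₂ hT₂ h₁ h₂ hy
    (blockDiagGL_graphIsoFun_mem hG₁ hT₁ hT₂ h₁ h₂ hy _) (by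
      have := Subgroup.mul_mem _ (blockDiagGL_graphIsoFun_mem hG₁ hT₁ hT₂ h₁ h₂ hy g)
        (blockDiagGL_graphIsoFun_mem hG₁ hT₁ hT₂ h₁ h₂ hy g')
      rwa [← map_mul, Prod.mk_mul_mk] at this))

/-- Graph property of `graphIso`. [cite: SpringerLAG1998, 9.6.2] -/
theorem blockDiagGL_graphIso_mem {y : Y} (hy : ∀ i, P.root' i y ≠ 0) (g : ↥G₁) :
    blockDiagGL ((g : GL n₁ k), ((graphIso hG₁ hT₁ hG₂ hT₂ h₁ h₂ hy g : ↥G₂) : GL n₂ k)) ∈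
      graphGroup h₁ h₂ hT₁.2.1 hT₂.2.1 (simpleRoots P y) :=
  blockDiagGL_graphIsoFun_mem hG₁ hT₁ hT₂ h₁ h₂ hy g

/-- **`H` is the graph of `graphIso`**: `diag(g, g') ∈ H ⇒ graphIso g = g'`. [cite: SpringerLAG1998, 9.6.2] -/
theorem graphIso_eq_of_mem {y : Y} (hy : ∀ i, P.root' i y ≠ 0) (g : ↥G₁) {g' : GL n₂ k}
    (hg' : blockDiagGL ((g : GL n₁ k), g') ∈ graphGroup h₁ h₂ hT₁.2.1 hT₂.2.1 (simpleRoots P y)) :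
    ((graphIso hG₁ hT₁ hG₂ hT₂ h₁ h₂ hy g : ↥G₂) : GL n₂ k) = g' :=
  snd_unique hG₁ hT₁ hG₂ hT₂ h₁ h₂ hy (blockDiagGL_graphIso_mem hG₁ hT₁ hG₂ hT₂ h₁ h₂ hy g) hg'

/-- `graphIso t = f_T t` on the torus. [cite: SpringerLAG1998, 9.6.2] -/
theorem graphIso_torus {y : Y} (hy : ∀ i, P.root' i y ≠ 0) (t : ↥T₁) :
    ((graphIso hG₁ hT₁ hG₂ hT₂ h₁ h₂ hy ⟨t, hT₁.1 t.2⟩ : ↥G₂) : GL n₂ k) =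
      (torusIsoOfWeights eX₁ eX₂ hT₁.2.1 hT₂.2.1 t : ↥T₂) :=
  graphIso_eq_of_mem hG₁ hT₁ hG₂ hT₂ h₁ h₂ hy _ (by
    have := graphTorusHom_mem_graphGroup h₁ h₂ hT₁.2.1 hT₂.2.1 (simpleRoots P y) t
    rwa [graphTorusHom_apply] at this)

/-! ### `graphIso` carries `u_i` to `x ↦ exp (x ψ(e¹_i))` for every root -/

/-- `ψ (e¹_i)` as a matrix. [folklore] -/
def psiRootE {y : Y} (hy : ∀ i, P.root' i y ≠ 0) (i : ι) : Matrix n₂ n₂ k :=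
  (psi hG₁ hT₁ hG₂ hT₂ h₁ h₂ hy ⟨h₁.rootE i, (h₁.rootE_mem i).1⟩ : Matrix n₂ n₂ k)

/-- `ψ (e¹_i) ∈ 𝔤₂_{α_i}`. [folklore] -/
lemma psiRootE_mem {y : Y} (hy : ∀ i, P.root' i y ≠ 0) (i : ι) :
    psiRootE hG₁ hT₁ hG₂ hT₂ h₁ h₂ hy i ∈ lieWeightSpace G₂ T₂ (charOfWeight eX₂ (P.root i)) :=
  psi_mem_lieWeightSpace hG₁ hT₁ hG₂ hT₂ h₁ h₂ hy (h₁.rootE_mem i)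

/-- `ψ (e¹_i) ≠ 0`. [folklore] -/
lemma psiRootE_ne_zero {y : Y} (hy : ∀ i, P.root' i y ≠ 0) (i : ι) : psiRootE hG₁ hT₁ hG₂ hT₂ h₁ h₂ hy i ≠ 0 := by
  haveI : Infinite k := IsAlgClosed.instInfinite
  intro h0
  have : (psi hG₁ hT₁ hG₂ hT₂ h₁ h₂ hy ⟨h₁.rootE i, (h₁.rootE_mem i).1⟩) = 0 := Subtype.ext h0
  have := (psi hG₁ hT₁ hG₂ hT₂ h₁ h₂ hy).injective (this.trans (map_zero _).symm)
  exact h₁.rootE_ne_zero i (congrArg Subtype.val this)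

/-- `ψ (e¹_i)` is nilpotent (a multiple of `e²_i`). [folklore] -/
lemma isNilpotent_psiRootE {y : Y} (hy : ∀ i, P.root' i y ≠ 0) (i : ι) :
    IsNilpotent (psiRootE hG₁ hT₁ hG₂ hT₂ h₁ h₂ hy i) := by
  obtain ⟨c, hc⟩ := (h₂.mem_lieWeightSpace_root_iff hG₂ hT₂ i).1 (psiRootE_mem hG₁ hT₁ hG₂ hT₂ h₁ h₂ hy i)
  rw [hc]
  exact (isNilpotent_of_fromBlocks₂ (isNilpotent_graphE h₁ h₂ hT₁.2.1 hT₂.2.1 i)).smul c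

/-- `exp (x ψ(e¹_i)) ∈ G₂`. [folklore] -/
lemma expHom_psiRootE_mem {y : Y} (hy : ∀ i, P.root' i y ≠ 0) (i : ι) (x : Multiplicative k) :
    expHom (psiRootE hG₁ hT₁ hG₂ hT₂ h₁ h₂ hy i) (isNilpotent_psiRootE hG₁ hT₁ hG₂ hT₂ h₁ h₂ hy i) x ∈ G₂ :=
  expHom_mem_of_mem_lieAlgebraGL hG₂.1.1 (psiRootE_mem hG₁ hT₁ hG₂ hT₂ h₁ h₂ hy i).1 _ x

/-- The weight-vector property of `ψ (e¹_i)` in the form used by `isRootHom_codRestrict_expHom`. [folklore] -/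
lemma conj_psiRootE {y : Y} (hy : ∀ i, P.root' i y ≠ 0) (i : ι) (t : ↥T₂) :
    ((t : GL n₂ k) : Matrix n₂ n₂ k) * psiRootE hG₁ hT₁ hG₂ hT₂ h₁ h₂ hy i * (((t : GL n₂ k)⁻¹ : GL n₂ k) : Matrix n₂ n₂ k) =
      ((charOfWeight eX₂ (P.root i) t : kˣ) : k) • psiRootE hG₁ hT₁ hG₂ hT₂ h₁ h₂ hy i := by
  rw [Matrix.coe_units_inv]
  exact (psiRootE_mem hG₁ hT₁ hG₂ hT₂ h₁ h₂ hy i).2 t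

/-- **The root homomorphism `u'_i (x) = exp (x ψ(e¹_i))` of `(G₂, T₂)` for `α_i`.** [cite: SpringerLAG1998, 8.1.1 (i)] -/
def psiRootHom {y : Y} (hy : ∀ i, P.root' i y ≠ 0) (i : ι) : Multiplicative k →* ↥G₂ :=
  (expHom (psiRootE hG₁ hT₁ hG₂ hT₂ h₁ h₂ hy i) (isNilpotent_psiRootE hG₁ hT₁ hG₂ hT₂ h₁ h₂ hy i)).codRestrict G₂
    (expHom_psiRootE_mem hG₁ hT₁ hG₂ hT₂ h₁ h₂ hy i)

/-- `u'_i` is a root homomorphism for `α_i`. [cite: SpringerLAG1998, 8.1.1 (i)] -/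
theorem isRootHom_psiRootHom {y : Y} (hy : ∀ i, P.root' i y ≠ 0) (i : ι) :
    IsRootHom G₂ T₂ h₂.le (charOfWeight eX₂ (P.root i)) (psiRootHom hG₁ hT₁ hG₂ hT₂ h₁ h₂ hy i) :=
  isRootHom_codRestrict_expHom h₂.le _ (psiRootE_ne_zero hG₁ hT₁ hG₂ hT₂ h₁ h₂ hy i) _
    (conj_psiRootE hG₁ hT₁ hG₂ hT₂ h₁ h₂ hy i)

/-- `diag(exp (x e¹_i), exp (x ψ e¹_i)) ∈ adStab` for every root index `i`. [cite: SpringerLAG1998, 9.6.2] -/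
theorem blockDiagGL_expHom_mem_adStab {y : Y} (hy : ∀ i, P.root' i y ≠ 0) (i : ι) (hn1 : IsNilpotent (h₁.rootE i))
    (x : Multiplicative k) :
    blockDiagGL (expHom (h₁.rootE i) hn1 x,
      expHom (psiRootE hG₁ hT₁ hG₂ hT₂ h₁ h₂ hy i) (isNilpotent_psiRootE hG₁ hT₁ hG₂ hT₂ h₁ h₂ hy i) x) ∈
      adStab hT₁ hT₂ h₁ h₂ y := by
  have hpair := mem_graph_psi hG₁ hT₁ hG₂ hT₂ h₁ h₂ hy ⟨h₁.rootE i, (h₁.rootE_mem i).1⟩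
  rw [blockDiagGL_mem_adStab_iff]
  refine ⟨expHom_mem_of_mem_lieAlgebraGL hG₁.1.1 (h₁.rootE_mem i).1 hn1 _,
    expHom_psiRootE_mem hG₁ hT₁ hG₂ hT₂ h₁ h₂ hy i x, fun d hd => ?_, fun d hd => ?_⟩
  · exact adPair_expHom_mem hT₁ hT₂ h₁ h₂ hpair hn1 _ _ hd
  · rw [← (expHom _ hn1).map_inv, ← (expHom _ (isNilpotent_psiRootE hG₁ hT₁ hG₂ hT₂ h₁ h₂ hy i)).map_inv]
    exact adPair_expHom_mem hT₁ hT₂ h₁ h₂ hpair hn1 _ _ hd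

include hG₁ hG₂ in
/-- **`graphIso (u_i (x)) = exp (x ψ(e¹_i))`** for `u_i = φ_i ∘ u⁺` and every root index `i`: the element
`z_x = graphIso (u_i x)⁻¹ exp (x ψ e¹_i)` lies in `T₂` (both pairs stabilise `D`), is unchanged under
`x ↦ χ_{α_i}(t) x` (conjugate by `diag(t, f_T t)`), hence constant in `x ≠ 0` (`χ_{α_i}` is onto `kˣ`),
and then trivial by additivity in `x`. [cite: SpringerLAG1998, 9.6.2] -/
theorem graphIso_rootSL2_upper {y : Y} (hy : ∀ i, P.root' i y ≠ 0) (i : ι) (x : Multiplicative k) :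
    ((graphIso hG₁ hT₁ hG₂ hT₂ h₁ h₂ hy ((h₁.rootSL2 i).comp unipotentUpperSL2 x) : ↥G₂) : GL n₂ k) =
      (psiRootHom hG₁ hT₁ hG₂ hT₂ h₁ h₂ hy i x : ↥G₂) := by
  haveI : Infinite k := IsAlgClosed.instInfinite
  set H := graphGroup h₁ h₂ hT₁.2.1 hT₂.2.1 (simpleRoots P y) with hH
  have hu := h₁.isRootHom_rootSL2_upper i
  have hv : hu.1.velocity = h₁.rootE i := h₁.velocity_rootSL2_upper i
  have hn1 : IsNilpotent (h₁.rootE i) := isNilpotent_of_fromBlocks₁ (isNilpotent_graphE h₁ h₂ hT₁.2.1 hT₂.2.1 i)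
  have hnil : IsNilpotent hu.1.velocity := by rw [hv]; exact hn1
  -- notation
  let a : k → GL n₁ k := fun c => (((h₁.rootSL2 i).comp unipotentUpperSL2 (Multiplicative.ofAdd c) : ↥G₁) : GL n₁ k)
  let b : k → GL n₂ k := fun c => expHom (psiRootE hG₁ hT₁ hG₂ hT₂ h₁ h₂ hy i)
    (isNilpotent_psiRootE hG₁ hT₁ hG₂ hT₂ h₁ h₂ hy i) (Multiplicative.ofAdd c)
  let F : k → GL n₂ k := fun c =>
    ((graphIso hG₁ hT₁ hG₂ hT₂ h₁ h₂ hy ((h₁.rootSL2 i).comp unipotentUpperSL2 (Multiplicative.ofAdd c)) : ↥G₂) : GL n₂ k)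
  have ha : ∀ c, a c = expHom (h₁.rootE i) hn1 (Multiplicative.ofAdd c) := by
    intro c
    have e := hu.coe_apply_eq_exp hG₁.1.1 hnil c
    rw [MonoidHom.comp_apply] at e
    change ((h₁.rootSL2 i (unipotentUpperSL2 (Multiplicative.ofAdd c)) : ↥G₁) : GL n₁ k) = _
    rw [e]
    exact expHom_congr _ _ hv _
  have hFH : ∀ c, blockDiagGL (a c, F c) ∈ H := fun c => blockDiagGL_graphIso_mem hG₁ hT₁ hG₂ hT₂ h₁ h₂ hy _
  have hbE : ∀ c, blockDiagGL (a c, b c) ∈ adStab hT₁ hT₂ h₁ h₂ y := by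
    intro c; rw [ha]; exact blockDiagGL_expHom_mem_adStab hG₁ hT₁ hG₂ hT₂ h₁ h₂ hy i hn1 _
  -- `z_c = F(c)⁻¹ b(c) ∈ T₂`
  let z : k → GL n₂ k := fun c => (F c)⁻¹ * b c
  have hzT : ∀ c, z c ∈ T₂ := by
    intro c
    refine mem_torus_of_inrBlock_mem_adStab hG₁ hT₁ hG₂ hT₂ h₁ h₂ hy ?_
    have := Subgroup.mul_mem _ (Subgroup.inv_mem _ (graphGroup_le_adStab hG₁ hT₁ hG₂ hT₂ h₁ h₂ y (hFH c))) (hbE c)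
    rwa [← map_inv, ← map_mul, Prod.inv_mk, Prod.mk_mul_mk, inv_mul_cancel, ← inrBlock_apply] at this
  -- torus invariance `z (χ(t) c) = z c`
  have hinv : ∀ (t : ↥T₁) (c : k), z (((charOfWeight eX₁ (P.root i) t : kˣ) : k) * c) = z c := by
    intro t c
    set s : kˣ := charOfWeight eX₁ (P.root i) t with hs
    set ft : ↥T₂ := torusIsoOfWeights eX₁ eX₂ hT₁.2.1 hT₂.2.1 t with hft
    -- `a (s c) = t a(c) t⁻¹`
    have haconj : a ((s : k) * c) = (t : GL n₁ k) * a c * ((t : GL n₁ k))⁻¹ := by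
      have e := congrArg (fun g : ↥G₁ => (g : GL n₁ k)) (hu.2.2 t c)
      simp only [Subgroup.coe_mul, Subgroup.coe_inv, Subgroup.coe_inclusion] at e
      exact e.symm
    -- `F (s c) = f_T(t) F(c) f_T(t)⁻¹`
    have hFconj : F ((s : k) * c) = ((ft : ↥T₂) : GL n₂ k) * F c * (((ft : ↥T₂) : GL n₂ k))⁻¹ := by
      change ((graphIso hG₁ hT₁ hG₂ hT₂ h₁ h₂ hy _ : ↥G₂) : GL n₂ k) = _
      have hprod : (h₁.rootSL2 i).comp unipotentUpperSL2 (Multiplicative.ofAdd ((s : k) * c)) =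
          ⟨(t : GL n₁ k), hT₁.1 t.2⟩ * (h₁.rootSL2 i).comp unipotentUpperSL2 (Multiplicative.ofAdd c) * ⟨(t : GL n₁ k), hT₁.1 t.2⟩⁻¹ := by
        apply Subtype.ext
        simp only [Subgroup.coe_mul, Subgroup.coe_inv]
        exact haconj
      rw [hprod, map_mul, map_mul, map_inv, Subgroup.coe_mul, Subgroup.coe_mul, Subgroup.coe_inv,
        graphIso_torus hG₁ hT₁ hG₂ hT₂ h₁ h₂ hy t]
    -- `b (s c) = f_T(t) b(c) f_T(t)⁻¹`
    have hbconj : b ((s : k) * c) = ((ft : ↥T₂) : GL n₂ k) * b c * (((ft : ↥T₂) : GL n₂ k))⁻¹ := by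
      apply Units.ext
      simp only [Units.val_mul]
      change IsNilpotent.exp (Multiplicative.toAdd (Multiplicative.ofAdd ((s : k) * c)) • _) = _
      rw [coe_expHom_apply, toAdd_ofAdd, toAdd_ofAdd, conj_exp_smul (isNilpotent_psiRootE hG₁ hT₁ hG₂ hT₂ h₁ h₂ hy i),
        conj_psiRootE hG₁ hT₁ hG₂ hT₂ h₁ h₂ hy i ft,
        smul_smul, hft, charOfWeight_torusIsoOfWeights, ← hs, mul_comm c]
    change (F ((s : k) * c))⁻¹ * b ((s : k) * c) = (F c)⁻¹ * b c
    rw [hFconj, hbconj, mul_inv_rev, mul_inv_rev, inv_inv]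
    have hcomm : ((ft : ↥T₂) : GL n₂ k) * ((F c)⁻¹ * b c) * (((ft : ↥T₂) : GL n₂ k))⁻¹ = (F c)⁻¹ * b c := by
      have e := congrArg Subtype.val (hT₂.2.1.2.1.is_comm.comm ft ⟨z c, hzT c⟩)
      change ((ft : ↥T₂) : GL n₂ k) * ((F c)⁻¹ * b c) = (F c)⁻¹ * b c * ((ft : ↥T₂) : GL n₂ k) at e
      rw [e, mul_inv_cancel_right]
    rw [← hcomm]; group
  -- `χ_{α_i}` is onto `kˣ`, so `z` is constant on `c ≠ 0`
  have hsurj : Function.Surjective (charOfWeight eX₁ (P.root i) : ↥T₁ →* kˣ) := by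
    have hne : (Additive.toMul (eX₁.symm (P.root i)) : ↥(characterLattice T₁)) ≠ 1 := by
      intro h1
      have : charOfWeight eX₁ (P.root i) = charOfWeight eX₁ 0 := by
        simp only [charOfWeight, map_zero, toMul_zero]; rw [h1]
      exact P.ne_zero i (charOfWeight_injective eX₁ this)
    exact surjective_of_ne_one_of_mem_characterLattice hT₁.2.1 hne
  have hconst : ∀ c : k, c ≠ 0 → z c = z 1 := by
    intro c hc
    obtain ⟨t, ht⟩ := hsurj (Units.mk0 c hc)
    have := hinv t 1
    rw [ht, Units.val_mk0, mul_one] at this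
    exact this
  -- additivity forces `z 1 = 1`
  have hbmul : ∀ c c' : k, b (c + c') = b c * b c' := fun c c' => by
    change expHom _ _ (Multiplicative.ofAdd (c + c')) = _; rw [ofAdd_add, map_mul]
  have hFmul : ∀ c c' : k, F (c + c') = F c * F c' := fun c c' => by
    change ((graphIso hG₁ hT₁ hG₂ hT₂ h₁ h₂ hy _ : ↥G₂) : GL n₂ k) = _
    rw [ofAdd_add, map_mul, map_mul, Subgroup.coe_mul]
  have hbz : ∀ c, b c = F c * z c := fun c => by change b c = F c * ((F c)⁻¹ * b c); rw [mul_inv_cancel_left]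
  have hz1 : z 1 = 1 := by
    have e : F 1 * F 1 * z 1 = F 1 * z 1 * (F 1 * z 1) := by
      have e0 := hbmul 1 1
      rw [hbz (1 + 1), hbz 1, hFmul 1 1, one_add_one_eq_two, hconst 2 two_ne_zero] at e0
      exact e0
    have e' : F 1 * (F 1 * z 1) = F 1 * (z 1 * (F 1 * z 1)) := by simpa only [mul_assoc] using e
    have e'' := mul_left_cancel e'
    have e3 : 1 * (F 1 * z 1) = z 1 * (F 1 * z 1) := by rwa [one_mul]
    exact (mul_right_cancel e3).symm
  -- conclude
  obtain ⟨c, rfl⟩ : ∃ c, Multiplicative.ofAdd c = x := ⟨x.toAdd, rfl⟩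
  change F c = b c
  by_cases hc : c = 0
  · subst hc
    change ((graphIso hG₁ hT₁ hG₂ hT₂ h₁ h₂ hy _ : ↥G₂) : GL n₂ k) = expHom _ _ (Multiplicative.ofAdd 0)
    rw [ofAdd_zero, map_one, map_one, map_one, Subgroup.coe_one]
  · rw [hbz, hconst c hc, hz1, mul_one]

/-! ### `graphIso` induces the identity of the root datum (`Fin`-indexed groups) -/

section Induces

variable {k : Type*} [Field k]
variable {ι X Y : Type*} [AddCommGroup X] [AddCommGroup Y]
variable {N N' : ℕ} {G T : Subgroup (GL (Fin N) k)} {G' T' : Subgroup (GL (Fin N') k)}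
  [IsMulCommutative ↥T] [IsMulCommutative ↥T']

/-- **`graphIso` induces the identity of the root datum.** [cite: SpringerLAG1998, 9.6.2] -/
theorem inducesRootDatumId_graphIso [IsAlgClosed k] [CharZero k] [Fintype ι]
    (hG₁ : IsConnectedReductive G) (hT₁ : IsMaximalTorusIn T G) (hG₂ : IsConnectedReductive G') (hT₂ : IsMaximalTorusIn T' G')
    {P : RootPairing ι ℤ X Y} {eX₁ : Additive ↥(characterLattice T) ≃+ X} {eY₁ : Additive ↥(cocharacterLattice T) ≃+ Y}
    {eX₂ : Additive ↥(characterLattice T') ≃+ X} {eY₂ : Additive ↥(cocharacterLattice T') ≃+ Y}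
    (h₁ : IsRootDatumOf G T P eX₁ eY₁) (h₂ : IsRootDatumOf G' T' P eX₂ eY₂) {y : Y} (hy : ∀ i, P.root' i y ≠ 0) :
    InducesRootDatumId h₁ h₂ (graphIso hG₁ hT₁ hG₂ hT₂ h₁ h₂ hy) := by
  have htorus : ∀ (g : ↥G) (hg : (g : GL (Fin N) k) ∈ T),
      ((graphIso hG₁ hT₁ hG₂ hT₂ h₁ h₂ hy g : ↥G') : GL (Fin N') k) =
        (torusIsoOfWeights eX₁ eX₂ hT₁.2.1 hT₂.2.1 ⟨g, hg⟩ : ↥T') := by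
    intro g hg
    have := graphIso_torus hG₁ hT₁ hG₂ hT₂ h₁ h₂ hy ⟨g, hg⟩
    exact (congrArg (fun g' : ↥G => ((graphIso hG₁ hT₁ hG₂ hT₂ h₁ h₂ hy g' : ↥G') : GL (Fin N') k))
      (Subtype.ext rfl : (⟨((⟨g, hg⟩ : ↥T) : GL (Fin N) k), hT₁.1 hg⟩ : ↥G) = g)).symm.trans this
  have hmem : ∀ g : ↥G, ((graphIso hG₁ hT₁ hG₂ hT₂ h₁ h₂ hy g : ↥G') : GL (Fin N') k) ∈ T' ↔ (g : GL (Fin N) k) ∈ T := by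
    intro g
    constructor
    · intro hg2
      -- `(g, graphIso g) ∈ H` and `(f_T⁻¹ (graphIso g), graphIso g) ∈ H`
      set t₂ : ↥T' := ⟨_, hg2⟩
      set t₁ : ↥T := (torusIsoOfWeights eX₁ eX₂ hT₁.2.1 hT₂.2.1).symm t₂
      have h1 := blockDiagGL_graphIso_mem hG₁ hT₁ hG₂ hT₂ h₁ h₂ hy g
      have h2 := graphTorusHom_mem_graphGroup h₁ h₂ hT₁.2.1 hT₂.2.1 (simpleRoots P y) t₁
      rw [graphTorusHom_apply, MulEquiv.apply_symm_apply] at h2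
      have := fst_unique hG₁ hT₁ hG₂ hT₂ h₁ h₂ hy h1 h2
      rw [this]; exact t₁.2
    · intro hg
      rw [htorus g hg]; exact (torusIsoOfWeights eX₁ eX₂ hT₁.2.1 hT₂.2.1 ⟨g, hg⟩).2
  refine ⟨hmem, fun x t ht => ?_, fun i => ?_⟩
  · have e : (⟨((graphIso hG₁ hT₁ hG₂ hT₂ h₁ h₂ hy t : ↥G') : GL (Fin N') k), (hmem t).mpr ht⟩ : ↥T') =
        torusIsoOfWeights eX₁ eX₂ hT₁.2.1 hT₂.2.1 ⟨t, ht⟩ := Subtype.ext (htorus t ht)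
      -- transport along `e`
    rw [e, charOfWeight_torusIsoOfWeights]
  · exact ⟨(h₁.rootSL2 i).comp unipotentUpperSL2, psiRootHom hG₁ hT₁ hG₂ hT₂ h₁ h₂ hy i,
      h₁.isRootHom_rootSL2_upper i, isRootHom_psiRootHom hG₁ hT₁ hG₂ hT₂ h₁ h₂ hy i,
      fun x => Subtype.ext (graphIso_rootSL2_upper hG₁ hT₁ hG₂ hT₂ h₁ h₂ hy i x)⟩



end Induces

end LieGraph


end Literature.NumberTheory.Automorphic
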